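import Literature.AnabelianGeometry.SemiGraphs.BCatBoundedRepresentatives
import Literature.AnabelianGeometry.SemiGraphs.TemperedPiExistence
import Literature.AnabelianGeometry.SemiGraphs.BObjDegree
import Literature.AnabelianGeometry.SemiGraphs.GaloisCountableOfStrictlyCoherent
import HarnessLib

/-!
# Finitely many finite étale coverings of bounded degree over a FINITE semi-graph of anabelioids, and
# finitely many open subgroups of bounded index in `π̂₁(𝒢)` ([SemiAnbd] Prop 5.2 (i) / Def 2.3 (iii))

Mochizuki, *Semi-graphs of anabelioids*, Publ. RIMS **42** (2006): §2 Def. 2.3 (iii) p. 25 (coherence: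
topologically finitely generated constituents), §3 Prop. 3.6 p. 38 (`π₁^temp(𝒢) := lim Gal(𝒢_{∞,i}/𝒢)`
over "some cofinal collection of connected finite étale Galois coverings"), §5 Prop. 5.2 (i) p. 63 /
proof p. 64 ("Assertions (i), (ii) follow from the various finiteness assumptions …").
[cite: MochizukiSemiAnbd2006, Prop 5.2 (i), p. 63]

abc-iut cell, layer L3, row **T54·E1b** (`HOME/plan/GAP-LEDGER.md` G-w4d053-1; L3-lead α31/α45; seat
abc-iut-w4-d048 gen 3).  The T54-B capstone prescribes its tower levels as abc-iut-w4-d053's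
CHARACTERISTIC OPEN CORES `charOpenCore Γ n` (`CharacteristicOpenCore.lean`: open, normal, of finite
index, fixed by every bi-continuous automorphism — GIVEN `hfin : (openSubgroupsIndexLE Γ n).Finite`),
consumed by abc-iut-L3-t9's `GaloisLevelData.ofGaloisSeq` (`GaloisLevelDataOfSeq.lean`).  This file
PROVES that finiteness input at the profinite fundamental group `π̂₁(𝒢) = Aut(𝒢.fiberAt v₀)` of the
Galois category `B(𝒢)` of a FINITE connected semi-graph of anabelioids `𝒢 : ProfiniteSemiGraph` whose
vertex and edge groups have it (e.g. are topologically finitely generated — coherence), WITHOUT claiming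
that `π̂₁(𝒢)` itself is topologically finitely generated:

* `ProfiniteSemiGraph.NFData` / `nfObj` / `finite_nfData` / `exists_iso_nfObj` — NORMAL FORMS: over a
  finite semi-graph, every object of `B(𝒢)` whose constituents have `≤ d` points is isomorphic to
  `nfObj D` for `D` in a FINITE type (a representative of `BCatBoundedRepresentatives.lean` at every
  vertex and edge, and gluing isomorphisms along the branches — finitely many by `finite_iso`);
* `card_constituents_eq` — all constituents have the cardinality of the fibre at `v₀` (`BObj.exists_degree`);
* `exists_nfData_stabilizer_eq` — an open subgroup `U ≤ Aut(fiberAt v₀)` of index in `[1, d]` is the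
  stabiliser of a point of the fibre of a normal-form object (the pointed covering `Aut F ⧸ U`, realised
  by `exists_obj_of_aut_action'`, then normalised);
* **`openSubgroupsIndexLE_autFiberAt_finite`** — hence `openSubgroupsIndexLE (Aut (𝒢.fiberAt v₀)) d` is
  FINITE; `…_of_tfg` from topological finite generation of the `Π_v`, `Π_e`; and
  **`charOpenCore_autFiberAt_family`** — the characteristic open cores of `π̂₁(𝒢)` are an antitone family
  of OPEN NORMAL FINITE-INDEX subgroups fixed by every bi-continuous automorphism and cofinal among the
  open finite-index subgroups (the conclusion shape of abc-iut-w4-d053's `charOpenCore_family_of_tfg`).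

Plumbing definitions only (`NFData`, `nfObj`); no `Prop` fact, no instance, no notation.  Nothing here
takes a side on [IUTchIII] Cor. 3.12; typed ≠ proved elsewhere, here everything stated is proved.
-/

namespace Literature.AnabelianGeometry.SemiGraphs

open CategoryTheory CategoryTheory.PreGaloisCategory Literature.AnabelianGeometry.Anabelioids
open Literature.AlgebraicGeometry.Frobenioids (BCat)
open Literature.AnabelianGeometry.AbsoluteAnabelian (IsTopologicallyFinitelyGenerated)
open scoped FintypeCatDiscrete

universe u

/-! ### Normal forms of objects of `B(𝒢)` of bounded degree over a FINITE semi-graph -/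

namespace ProfiniteSemiGraph

variable (𝒢 : ProfiniteSemiGraph.{u}) {d : ℕ}
  (hV : ∀ v : 𝒢.graph.Vertex, (openSubgroupsIndexLE (𝒢.Gv v) d).Finite)
  (hE : ∀ e : 𝒢.graph.Edge, (openSubgroupsIndexLE (𝒢.Ge e) d).Finite)

/-- Normal-form data for objects of `B(𝒢)` of degree `≤ d`: a representative index at every vertex
and edge, and gluing isomorphisms between the corresponding representatives along every branch.
[cite: MochizukiSemiAnbd2006, Prop 5.2 (i), p. 63] -/
def NFData : Type u :=
  Σ (sV : ∀ v : 𝒢.graph.Vertex, BoundedGSets.RepIndex (𝒢.Gv v) d)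
    (sE : ∀ e : 𝒢.graph.Edge, BoundedGSets.RepIndex (𝒢.Ge e) d),
    ∀ (b : 𝒢.graph.Branch) (v : 𝒢.graph.Vertex) (h : 𝒢.graph.abuts b = some v),
      (𝒢.toAnab.pull b v h).pullback.obj (BoundedGSets.rep (hV v) (sV v)) ≅
        BoundedGSets.rep (hE (𝒢.graph.edgeOf b)) (sE (𝒢.graph.edgeOf b))

variable {𝒢 hV hE}

/-- The object of `B(𝒢)` in normal form attached to normal-form data.
[cite: MochizukiSemiAnbd2006, Prop 5.2 (i), p. 63] -/
noncomputable def nfObj (D : NFData 𝒢 hV hE) : 𝒢.toAnab.BObj where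
  S v := BoundedGSets.rep (hV v) (D.1 v)
  T e := BoundedGSets.rep (hE e) (D.2.1 e)
  ψ := D.2.2

variable (𝒢 hV hE) in
/-- Over a finite semi-graph the normal-form data form a finite type.
[cite: MochizukiSemiAnbd2006, Prop 5.2 (i), p. 63] -/
theorem finite_nfData [Finite 𝒢.graph.Vertex] [Finite 𝒢.graph.Branch] :
    Finite (NFData 𝒢 hV hE) := by
  haveI : Finite 𝒢.graph.Edge :=
    Finite.of_surjective 𝒢.graph.edgeOf fun e => by
      obtain ⟨b₁, -, -, h₁, -⟩ := 𝒢.graph.two_branches e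
      exact ⟨b₁, h₁⟩
  haveI : ∀ v, Finite (BoundedGSets.RepIndex (𝒢.Gv v) d) := fun v =>
    BoundedGSets.finite_repIndex (hV v)
  haveI : ∀ e, Finite (BoundedGSets.RepIndex (𝒢.Ge e) d) := fun e =>
    BoundedGSets.finite_repIndex (hE e)
  haveI : ∀ (sV : ∀ v : 𝒢.graph.Vertex, BoundedGSets.RepIndex (𝒢.Gv v) d)
      (sE : ∀ e : 𝒢.graph.Edge, BoundedGSets.RepIndex (𝒢.Ge e) d)
      (b : 𝒢.graph.Branch) (v : 𝒢.graph.Vertex) (h : 𝒢.graph.abuts b = some v),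
      Finite ((𝒢.toAnab.pull b v h).pullback.obj (BoundedGSets.rep (hV v) (sV v)) ≅
        BoundedGSets.rep (hE (𝒢.graph.edgeOf b)) (sE (𝒢.graph.edgeOf b))) :=
    fun sV sE b v h => BoundedGSets.finite_iso _ _
  unfold NFData
  infer_instance

/-- **Normal form of objects of bounded degree**: an object of `B(𝒢)` all of whose vertex and edge
constituents have at most `d` points is isomorphic to the object attached to some normal-form data.
[cite: MochizukiSemiAnbd2006, Prop 5.2 (i), p. 63] -/
theorem exists_iso_nfObj (X : 𝒢.toAnab.BObj) (hXV : ∀ v, Nat.card (X.S v).obj.V ≤ d)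
    (hXE : ∀ e, Nat.card (X.T e).obj.V ≤ d) :
    ∃ D : NFData 𝒢 hV hE, Nonempty (X ≅ nfObj D) := by
  have hαV := fun v => BoundedGSets.exists_iso_rep (hV v) (X.S v) (hXV v)
  have hβE := fun e => BoundedGSets.exists_iso_rep (hE e) (X.T e) (hXE e)
  choose sV hsV using hαV
  choose sE hsE using hβE
  let α : ∀ v : 𝒢.graph.Vertex,
      X.S v ≅ (show 𝒢.toAnab.V v from BoundedGSets.rep (hV v) (sV v)) := fun v => (hsV v).some
  let β : ∀ e : 𝒢.graph.Edge,
      X.T e ≅ (show 𝒢.toAnab.E e from BoundedGSets.rep (hE e) (sE e)) := fun e => (hsE e).some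
  let D : NFData 𝒢 hV hE := ⟨sV, sE, fun b v h =>
    ((𝒢.toAnab.pull b v h).pullback.mapIso (α v)).symm ≪≫ X.ψ b v h ≪≫ β (𝒢.graph.edgeOf b)⟩
  refine ⟨D, ⟨{ hom := ⟨fun v => (α v).hom, fun e => (β e).hom, fun b v h => ?_⟩,
                inv := ⟨fun v => (α v).inv, fun e => (β e).inv, fun b v h => ?_⟩,
                hom_inv_id := ?_, inv_hom_id := ?_ }⟩⟩
  · change (𝒢.toAnab.pull b v h).pullback.map (α v).hom ≫
        (((𝒢.toAnab.pull b v h).pullback.mapIso (α v)).symm ≪≫ X.ψ b v h ≪≫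
          β (𝒢.graph.edgeOf b)).hom = (X.ψ b v h).hom ≫ (β (𝒢.graph.edgeOf b)).hom
    simp
  · change (𝒢.toAnab.pull b v h).pullback.map (α v).inv ≫ (X.ψ b v h).hom =
        (((𝒢.toAnab.pull b v h).pullback.mapIso (α v)).symm ≪≫ X.ψ b v h ≪≫
          β (𝒢.graph.edgeOf b)).hom ≫ (β (𝒢.graph.edgeOf b)).inv
    simp only [Iso.trans_hom, Iso.symm_hom, Functor.mapIso_inv, Category.assoc]
    erw [Iso.hom_inv_id, Category.comp_id]
    rfl
  · ext <;> simp
  · ext <;> simp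

end ProfiniteSemiGraph

/-! ### Finitely many open subgroups of bounded index in `π̂₁(𝒢) = Aut(fiberAt v₀)` -/

namespace ProfiniteSemiGraph

variable (𝒢 : ProfiniteSemiGraph.{u}) {d : ℕ}
  (hV : ∀ v : 𝒢.graph.Vertex, (openSubgroupsIndexLE (𝒢.Gv v) d).Finite)
  (hE : ∀ e : 𝒢.graph.Edge, (openSubgroupsIndexLE (𝒢.Ge e) d).Finite)

/-- Every vertex and edge constituent of an object of `B(𝒢)` (`𝒢` connected) has as many points as the
vertex constituent at `v₀`. [cite: MochizukiSemiAnbd2006, Def. 2.2 (i), p. 23] -/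
theorem card_constituents_eq (hc : 𝒢.graph.IsConnected) (v₀ : 𝒢.graph.Vertex) (X : 𝒢.toAnab.BObj) :
    (∀ v : 𝒢.graph.Vertex, Nat.card (X.S v).obj.V = Nat.card (X.S v₀).obj.V) ∧
      ∀ e : 𝒢.graph.Edge, Nat.card (X.T e).obj.V = Nat.card (X.S v₀).obj.V := by
  obtain ⟨n, hSn, hTn⟩ := SemiGraphOfAnabelioids.BObj.exists_degree 𝒢.toAnab ⟨hc⟩ X
  have hS : ∀ v : 𝒢.graph.Vertex, Nat.card (X.S v).obj.V = n := fun v =>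
    @hSn v (ObjectProperty.ι (Action.IsContinuous (V := FintypeCat.{u}) (G := 𝒢.Gv v)) ⋙
      Action.forget FintypeCat.{u} (𝒢.Gv v)) (by exact Anabelioids.fiberFunctor_forget_bCat (𝒢.Gv v))
  have hT : ∀ e : 𝒢.graph.Edge, Nat.card (X.T e).obj.V = n := fun e =>
    @hTn e (ObjectProperty.ι (Action.IsContinuous (V := FintypeCat.{u}) (G := 𝒢.Ge e)) ⋙
      Action.forget FintypeCat.{u} (𝒢.Ge e)) (by exact Anabelioids.fiberFunctor_forget_bCat (𝒢.Ge e))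
  exact ⟨fun v => (hS v).trans (hS v₀).symm, fun e => (hT e).trans (hS v₀).symm⟩

/-- **Key step**: every open subgroup of `Aut(fiberAt v₀)` of index in `[1, d]` is the stabiliser of a
point of the fibre of an object of `B(𝒢)` IN NORMAL FORM. [cite: MochizukiSemiAnbd2006, Prop 5.2 (i), p. 63] -/
theorem exists_nfData_stabilizer_eq (hc : 𝒢.graph.IsConnected) (v₀ : 𝒢.graph.Vertex)
    (U : Subgroup (letI := SemiGraphOfAnabelioids.galoisCategory_bObj 𝒢.toAnab ⟨hc⟩;
      Aut (𝒢.fiberAt v₀)))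
    (hU : letI := SemiGraphOfAnabelioids.galoisCategory_bObj 𝒢.toAnab ⟨hc⟩;
      U ∈ openSubgroupsIndexLE (Aut (𝒢.fiberAt v₀)) d) :
    letI := SemiGraphOfAnabelioids.galoisCategory_bObj 𝒢.toAnab ⟨hc⟩
    ∃ (D : NFData 𝒢 hV hE) (x : (𝒢.fiberAt v₀).obj (nfObj D)),
      MulAction.stabilizer (Aut (𝒢.fiberAt v₀)) x = U := by
  letI := SemiGraphOfAnabelioids.galoisCategory_bObj 𝒢.toAnab ⟨hc⟩
  haveI := 𝒢.fiberFunctor_fiberAt hc v₀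
  obtain ⟨hUo, hUpos, hUd⟩ := hU
  haveI : U.FiniteIndex := ⟨Nat.pos_iff_ne_zero.mp hUpos⟩
  haveI : Finite (Aut (𝒢.fiberAt v₀) ⧸ U) := Subgroup.finite_quotient_of_finiteIndex
  -- the stabilisers of the cosets `g U` are the (open) conjugates of `U`
  have hstab : ∀ y : Aut (𝒢.fiberAt v₀) ⧸ U,
      IsOpen (MulAction.stabilizer (Aut (𝒢.fiberAt v₀)) y : Set (Aut (𝒢.fiberAt v₀))) := by
    intro y
    induction y using QuotientGroup.induction_on with
    | H g =>
      have : (MulAction.stabilizer (Aut (𝒢.fiberAt v₀)) ((g : Aut (𝒢.fiberAt v₀)) :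
            Aut (𝒢.fiberAt v₀) ⧸ U) : Set (Aut (𝒢.fiberAt v₀))) =
          (fun σ => g⁻¹ * σ * g) ⁻¹' (U : Set (Aut (𝒢.fiberAt v₀))) := by
        ext σ
        simp only [SetLike.mem_coe, MulAction.mem_stabilizer_iff, Set.mem_preimage,
          MulAction.Quotient.smul_coe, QuotientGroup.eq, smul_eq_mul]
        rw [show (σ * g)⁻¹ * g = (g⁻¹ * σ * g)⁻¹ by group, inv_mem_iff]
      rw [this]
      exact hUo.preimage ((continuous_const.mul continuous_id).mul continuous_const)
  obtain ⟨X, e, he⟩ :=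
    SemiGraphOfAnabelioids.exists_obj_of_aut_action' (𝒢.fiberAt v₀) (Aut (𝒢.fiberAt v₀) ⧸ U) hstab
  -- the degree of `X` is the index of `U`
  have hXv₀ : Nat.card (X.S v₀).obj.V ≤ d := by
    change Nat.card ((𝒢.fiberAt v₀).obj X) ≤ d
    rw [Nat.card_congr e, ← Subgroup.index_eq_card]
    exact hUd
  obtain ⟨hSX, hTX⟩ := card_constituents_eq 𝒢 hc v₀ X
  obtain ⟨D, ⟨φ⟩⟩ := exists_iso_nfObj (hV := hV) (hE := hE) X
    (fun v => (hSX v).le.trans hXv₀) (fun e => (hTX e).le.trans hXv₀)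
  -- the point: the coset `U` itself, transported along `e` and `φ`
  refine ⟨D, (𝒢.fiberAt v₀).map φ.hom (e.symm ((1 : Aut (𝒢.fiberAt v₀)) : Aut (𝒢.fiberAt v₀) ⧸ U)),
    ?_⟩
  have hinj : Function.Injective
      ((𝒢.fiberAt v₀).map φ.hom : (𝒢.fiberAt v₀).obj X → (𝒢.fiberAt v₀).obj (nfObj D)) :=
    (FintypeCat.equivEquivIso.symm ((𝒢.fiberAt v₀).mapIso φ)).injective
  ext σ
  rw [MulAction.mem_stabilizer_iff, PreGaloisCategory.mulAction_naturality, hinj.eq_iff,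
    ← e.injective.eq_iff, he, Equiv.apply_symm_apply, ← MulAction.mem_stabilizer_iff,
    MulAction.stabilizer_quotient]

/-- **Finitely many open subgroups of bounded index in `π̂₁(𝒢) = Aut(fiberAt v₀)`** for a FINITE
connected semi-graph of anabelioids whose vertex and edge groups have finitely many open subgroups of
index `≤ d` (e.g. are topologically finitely generated: [SemiAnbd] Def. 2.3 (iii) coherence) — the
finiteness input `hfin` of abc-iut-w4-d053's characteristic open cores (`CharacteristicOpenCore.lean`)
at the group of the Galois tower of [SemiAnbd] Prop. 3.6 / Prop. 5.2 (i).
[cite: MochizukiSemiAnbd2006, Prop 5.2 (i), p. 63] -/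
theorem openSubgroupsIndexLE_autFiberAt_finite
    (hV : ∀ v : 𝒢.graph.Vertex, (openSubgroupsIndexLE (𝒢.Gv v) d).Finite)
    (hE : ∀ e : 𝒢.graph.Edge, (openSubgroupsIndexLE (𝒢.Ge e) d).Finite)
    [Finite 𝒢.graph.Vertex] [Finite 𝒢.graph.Branch]
    (hc : 𝒢.graph.IsConnected) (v₀ : 𝒢.graph.Vertex) :
    letI := SemiGraphOfAnabelioids.galoisCategory_bObj 𝒢.toAnab ⟨hc⟩
    (openSubgroupsIndexLE (Aut (𝒢.fiberAt v₀)) d).Finite := by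
  letI := SemiGraphOfAnabelioids.galoisCategory_bObj 𝒢.toAnab ⟨hc⟩
  haveI := finite_nfData 𝒢 hV hE
  choose D x hDx using fun U : ↥(openSubgroupsIndexLE (Aut (𝒢.fiberAt v₀)) d) =>
    exists_nfData_stabilizer_eq 𝒢 hV hE hc v₀ U.1 U.2
  refine Set.finite_coe_iff.mp (Finite.of_injective
    (fun U => (⟨D U, x U⟩ : Σ D' : NFData 𝒢 hV hE, (𝒢.fiberAt v₀).obj (nfObj D'))) ?_)
  intro U U' h
  apply Subtype.ext
  rw [← hDx U, ← hDx U']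
  exact congrArg (fun p : (Σ D' : NFData 𝒢 hV hE, (𝒢.fiberAt v₀).obj (nfObj D')) =>
    MulAction.stabilizer (Aut (𝒢.fiberAt v₀)) p.2) h

/-- The same for all `d` at once, from TOPOLOGICAL FINITE GENERATION of the vertex and edge groups
([SemiAnbd] Def. 2.3 (iii): "coherent"), via abc-iut-w4-d053's
`openSubgroupsIndexLE_finite_of_isTopologicallyFinitelyGenerated` (abc-iut-L5-t6's
`finite_setOf_isOpen_index`). [cite: MochizukiSemiAnbd2006, Prop 5.2 (i), p. 63] -/
theorem openSubgroupsIndexLE_autFiberAt_finite_of_tfg [Finite 𝒢.graph.Vertex] [Finite 𝒢.graph.Branch]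
    (hc : 𝒢.graph.IsConnected) (v₀ : 𝒢.graph.Vertex)
    (hVt : ∀ v : 𝒢.graph.Vertex, IsTopologicallyFinitelyGenerated (𝒢.Gv v))
    (hEt : ∀ e : 𝒢.graph.Edge, IsTopologicallyFinitelyGenerated (𝒢.Ge e)) (n : ℕ) :
    letI := SemiGraphOfAnabelioids.galoisCategory_bObj 𝒢.toAnab ⟨hc⟩
    (openSubgroupsIndexLE (Aut (𝒢.fiberAt v₀)) n).Finite :=
  openSubgroupsIndexLE_autFiberAt_finite 𝒢
    (fun v => openSubgroupsIndexLE_finite_of_isTopologicallyFinitelyGenerated (hVt v) n)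
    (fun e => openSubgroupsIndexLE_finite_of_isTopologicallyFinitelyGenerated (hEt e) n) hc v₀

/-- **The characteristic open cores of `π̂₁(𝒢)` are a prescribed cofinal family of finite levels**
(finite coherent `𝒢`): `n ↦ charOpenCore (Aut (𝒢.fiberAt v₀)) n` is antitone, each member is OPEN,
NORMAL, of FINITE INDEX and fixed by every bi-continuous automorphism of `π̂₁(𝒢)`, and every open
subgroup of finite index contains one of them — the conclusion shape of abc-iut-w4-d053's
`charOpenCore_family_of_tfg`, here WITHOUT assuming `π̂₁(𝒢)` topologically finitely generated.
[cite: MochizukiSemiAnbd2006, Prop 5.2 (i), p. 63] -/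
theorem charOpenCore_autFiberAt_family [Finite 𝒢.graph.Vertex] [Finite 𝒢.graph.Branch]
    (hc : 𝒢.graph.IsConnected) (v₀ : 𝒢.graph.Vertex)
    (hVt : ∀ v : 𝒢.graph.Vertex, IsTopologicallyFinitelyGenerated (𝒢.Gv v))
    (hEt : ∀ e : 𝒢.graph.Edge, IsTopologicallyFinitelyGenerated (𝒢.Ge e)) :
    letI := SemiGraphOfAnabelioids.galoisCategory_bObj 𝒢.toAnab ⟨hc⟩
    Antitone (charOpenCore (Aut (𝒢.fiberAt v₀))) ∧
      (∀ n, IsOpen (charOpenCore (Aut (𝒢.fiberAt v₀)) n : Set (Aut (𝒢.fiberAt v₀))) ∧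
        (charOpenCore (Aut (𝒢.fiberAt v₀)) n).Normal ∧
        (charOpenCore (Aut (𝒢.fiberAt v₀)) n).FiniteIndex ∧
        ∀ φ : MulAut (Aut (𝒢.fiberAt v₀)), Continuous φ → Continuous φ.symm →
          (charOpenCore (Aut (𝒢.fiberAt v₀)) n).map φ.toMonoidHom =
            charOpenCore (Aut (𝒢.fiberAt v₀)) n) ∧
      ∀ U : Subgroup (Aut (𝒢.fiberAt v₀)), IsOpen (U : Set (Aut (𝒢.fiberAt v₀))) → U.FiniteIndex →
        ∃ n, charOpenCore (Aut (𝒢.fiberAt v₀)) n ≤ U := by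
  letI := SemiGraphOfAnabelioids.galoisCategory_bObj 𝒢.toAnab ⟨hc⟩
  have hfin := fun n => openSubgroupsIndexLE_autFiberAt_finite_of_tfg 𝒢 hc v₀ hVt hEt n
  exact ⟨fun _ _ h => charOpenCore_anti h,
    fun n => ⟨isOpen_charOpenCore (hfin n), charOpenCore_normal n,
      Subgroup.finiteIndex_iff.mpr (charOpenCore_index_ne_zero (hfin n)),
      fun φ hφ hφ' => map_charOpenCore_eq φ hφ hφ'⟩,
    fun U hU _ => ⟨U.index, charOpenCore_le_of_finiteIndex U hU⟩⟩

end ProfiniteSemiGraph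

end Literature.AnabelianGeometry.SemiGraphs
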